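import Summits.FinalStateConjecture.FinalStateConjecture.Theses.PhaseMixingCapture
import Summits.FinalStateConjecture.FinalStateConjecture.Theorems.PhaseMixingCaptureCaptureSufficesReduction
import Summits.FinalStateConjecture.FinalStateConjecture.Theorems.CaptureSuffices.Negative.AdversarialWitnesses

/-!
# `CaptureSufficesC2` / `BulkKerrCaptureC2` (cruxes 14986 / 14985, route `PhaseMixingCapture`):
# what a consumer of the successor bulk hypothesis actually receives — adversarial `(s, δ)` and a bare chart

Negative-side support file of the crux disprover of `CaptureSufficesC2` (cdisprove seat). Everything
proved, no definitions, no named facts. Three typed facts about the HYPOTHESIS `BulkKerrCaptureC2` of the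
crux (item 14985, typing ruling 2026-08-16: convergence order pinned to `k = 2`, qualitative modulus,
b-conormal data) as it reaches a prover of the crux — in particular the picked line's
`stub_softShieldedDecomposition` (`Cruxes/CaptureSufficesC2/Lines/Sketch.lean`):

* `bulkKerrCaptureC2_iff_sharp` — the statement is existential in `(s, δ)` with a monotone witness set
  (both the `ε`-closeness clause and the conormality clause `∀ s', dist_{s',δ} < ⊤` are antitone in
  `(s, δ)`), hence EQUIVALENT to its form with `s ≥ s₀`, `δ ≥ δ₀` for every threshold: a consumer receives
  basins and the conormal class in a topology with `δ` beyond any bound (for `δ ≥ -1/2` these pin the ADM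
  mass, `CaptureSuffices.Negative.KerrMassPinningCritical`). The ruling removed the adversarial `k = 0` of
  the pre-ruling statement, not the adversarial `(s, δ)`.
* `exists_convergesTo_iff_chart` (generic `ModelBackground`), `exists_convergesToKerr_iff_chart`,
  `bulkKerrCaptureC2_iff_chartForm` — **the existential region `𝒟oc` is decoration**: the covering clause
  of `IsLateEmbedding` is discharged by `𝒟 := Ψ '' lateRegion τ₀`, so `∃ 𝒟oc, ConvergesToKerr 𝒟oc M' a' 2`
  hands over a late CHART (smooth, open embedding of `{t* > τ₀}`, `C²` deviation on the slabs `→ 0`) and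
  NO statement about what it covers — whereas the summit pins its region (`O = exteriorOf 𝒟 d.charted`,
  `HasExhaustiveCharts`). This is the kernel-checked core of the typing alert "B2" of the crux chain
  (`Cruxes/CaptureSufficesC2/BarrierNotesIdeator2.md`): a decomposition with exhaustive charts cannot be
  READ OFF the hypothesis; inward coverage down to the event horizon must be manufactured by the prover
  or pinned by the planner in item 14985.
* `exists_subextremal_within` — the qualitative modulus `|M' − M| + |a' − a| ≤ η` tolerates the closed
  spin range and the zero-mass corner, so the parameter-bookkeeping kills of the pre-ruling bulk
  statement's side conditions (`BulkKerrCapture.Negative.bulkCaptureFamily_false_without_spinGap /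
  _posMass`) do not port to the successor: its `a₁ < 1`, `0 < M` are load-bearing only through
  far-completeness and `C²` convergence.
-/

-- the problem namespace `FinalStateConjecture.FinalStateConjecture` (single-conjunct summit) trips dupNamespace
set_option linter.dupNamespace false

noncomputable section

open scoped Manifold ContDiff Topology ENNReal
open Set Filter Topology

namespace Summit.FinalStateConjecture.FinalStateConjecture.Theorems.CaptureSufficesC2.Negative

open Literature.Geometry.Lorentzian
open Summit.FinalStateConjecture.FinalStateConjecture.Theses.PhaseMixingCapture (BulkKerrCaptureC2)
open Summit.FinalStateConjecture.FinalStateConjecture.Theorems.PhaseMixingCaptureCaptureSuffices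
  (bulkKerrCaptureC2_iff)
open Summit.FinalStateConjecture.FinalStateConjecture.Theorems.CaptureSuffices.Negative
  (dataWeightedSobolevEDist_mono_indices)

/-! ## §1 The successor bulk hypothesis in SHARP `(s, δ)` form -/

/-- **Sharpening `BulkKerrCaptureC2` in `(s, δ)` costs nothing.** For every threshold `(s₀, δ₀)` the
successor bulk statement is EQUIVALENT to its form with `s ≥ s₀`, `δ ≥ δ₀`: both the `ε`-closeness clause
and the b-conormality clause `∀ s', dist_{s',δ} < ⊤` are antitone in `(s, δ)`
(`dataWeightedSobolevEDist_mono_indices`). A consumer of the hypothesis therefore receives basins and the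
conormal class in a topology `H^s_δ` with `δ` beyond any bound — for `δ ≥ -1/2` two Kerr–Schild leaf data
of different mass are at infinite distance (`KerrMassPinningCritical`, landed), so such basins contain no
Cauchy slice of a development that has radiated. [folklore] -/
theorem bulkKerrCaptureC2_iff_sharp (s₀ : ℕ) (δ₀ : ℝ) :
    BulkKerrCaptureC2 ↔
      ∀ [Kerr.Facts] [Kerr.SliceFacts], ∀ a₁ : ℝ, a₁ < 1 → ∃ (s : ℕ) (δ : ℝ), (s₀ ≤ s ∧ δ₀ ≤ δ) ∧
        ∀ (M : ℝ) (hM : 0 < M), ∀ η > (0 : ℝ), ∃ ε > (0 : ℝ), ∀ a : ℝ, |a| ≤ a₁ * M →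
          ∀ (D : InitialDataSet 𝓘(ℝ, E3) (Kerr.slice a M)) [D.metric.HasLeviCivita],
            D.IsVacuumConstraintSolution →
            (∀ s' : ℕ, InitialDataSet.dataWeightedSobolevEDist s' δ D (Kerr.data M a M hM.le) < ⊤) →
            InitialDataSet.dataWeightedSobolevEDist s δ D (Kerr.data M a M hM.le) <
              ENNReal.ofReal ε →
            ∀ 𝒟 : VacuumCauchyDevelopment D, 𝒟.IsMaximal →
              ∃ (M' a' : ℝ) (𝒟oc : Set 𝒟.carrier), Kerr.IsSubextremal M' a' ∧
                𝒟.HasCompleteFutureNullInfinityFar ∧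
                𝒟.toSpacetime.ConvergesToKerr 𝒟oc M' a' 2 ∧ |M' - M| + |a' - a| ≤ η := by
  rw [bulkKerrCaptureC2_iff]
  constructor
  · intro h hF hSF a₁ ha₁
    obtain ⟨s, δ, H⟩ := @h hF hSF a₁ ha₁
    refine ⟨max s s₀, max δ δ₀, ⟨le_max_right _ _, le_max_right _ _⟩, ?_⟩
    intro M hM η hη
    obtain ⟨ε, hε, Hε⟩ := H M hM η hη
    refine ⟨ε, hε, fun a ha D _ hvac hcon hdist 𝒟 hmax ↦ ?_⟩
    refine Hε a ha D hvac (fun s' ↦ ?_) ?_ 𝒟 hmax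
    · exact lt_of_le_of_lt (dataWeightedSobolevEDist_mono_indices le_rfl (le_max_left δ δ₀) _ _)
        (hcon s')
    · exact lt_of_le_of_lt
        (dataWeightedSobolevEDist_mono_indices (le_max_left s s₀) (le_max_left δ δ₀) _ _) hdist
  · intro h hF hSF a₁ ha₁
    obtain ⟨s, δ, -, H⟩ := @h hF hSF a₁ ha₁
    exact ⟨s, δ, H⟩

/-! ## §2 The existential region is decoration (typing alert B2, formal) -/

section ChartForm

universe u

/-- **`∃ 𝒟, ConvergesTo B 𝒟 k` is a statement about a CHART only.** The covering clause of
`IsLateEmbedding` (`𝒟 ∖ Ψ(late region) ⊆ J⁻(Ψ(slab τ₀))`) is discharged by the choice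
`𝒟 := Ψ '' lateRegion τ₀`, so an existentially quantified region carries no covering information: the
consumer receives a smooth map of the reference domain, an open embedding of `{t > τ₀}`, and `Cᵏ`
deviation on the slabs tending to `0` — nothing about how much of the spacetime (e.g. of the true exterior
down to the event horizon) the chart covers. [folklore] -/
theorem exists_convergesTo_iff_chart (𝓢 : Spacetime.{u} 4) (B : ModelBackground) (k : ℕ) :
    (∃ 𝒟 : Set 𝓢.carrier, 𝓢.ConvergesTo B 𝒟 k) ↔
      ∃ (τ₀ : ℝ) (Ψ : B.domain → 𝓢.carrier), ContMDiff 𝓘(ℝ, E4) (𝓡 4) ∞ Ψ ∧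
        IsOpenEmbedding ((B.lateRegion τ₀).restrict Ψ) ∧
        Tendsto (fun τ ↦ 𝓢.deviationCk B Ψ k τ) atTop (𝓝 0) := by
  constructor
  · rintro ⟨𝒟, τ₀, Ψ, hΨ, ht⟩
    exact ⟨τ₀, Ψ, hΨ.contMDiff, hΨ.isOpenEmbedding, ht⟩
  · rintro ⟨τ₀, Ψ, hc, ho, ht⟩
    refine ⟨Ψ '' B.lateRegion τ₀, τ₀, Ψ, ⟨⟨hc, ho, subset_rfl⟩, ?_⟩, ht⟩
    exact fun x hx ↦ (hx.2 hx.1).elim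

/-- Kerr specialisation: `∃ 𝒟oc, ConvergesToKerr 𝒟oc M a k` is a chart statement. [folklore] -/
theorem exists_convergesToKerr_iff_chart (𝓢 : Spacetime.{u} 4) (M a : ℝ) (k : ℕ) :
    (∃ 𝒟oc : Set 𝓢.carrier, 𝓢.ConvergesToKerr 𝒟oc M a k) ↔
      ∃ (τ₀ : ℝ) (Ψ : Kerr.exterior M a → 𝓢.carrier), ContMDiff 𝓘(ℝ, E4) (𝓡 4) ∞ Ψ ∧
        IsOpenEmbedding ((Kerr.lateRegion M a τ₀).restrict Ψ) ∧
        Tendsto (fun τ ↦ 𝓢.deviationCk (Kerr.background M a) Ψ k τ) atTop (𝓝 0) :=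
  exists_convergesTo_iff_chart 𝓢 (Kerr.background M a) k

end ChartForm

/-- **`BulkKerrCaptureC2` in chart form** — the exact content handed to a consumer (the line's Stub 4 in
particular): sub-extremal final parameters within `η`, far-completeness, and a late CHART modelled on
`Kerr.exterior M' a'` with `C²` deviation tending to `0`; no region, no covering clause. [folklore] -/
theorem bulkKerrCaptureC2_iff_chartForm :
    BulkKerrCaptureC2 ↔
      ∀ [Kerr.Facts] [Kerr.SliceFacts], ∀ a₁ : ℝ, a₁ < 1 → ∃ (s : ℕ) (δ : ℝ),
        ∀ (M : ℝ) (hM : 0 < M), ∀ η > (0 : ℝ), ∃ ε > (0 : ℝ), ∀ a : ℝ, |a| ≤ a₁ * M →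
          ∀ (D : InitialDataSet 𝓘(ℝ, E3) (Kerr.slice a M)) [D.metric.HasLeviCivita],
            D.IsVacuumConstraintSolution →
            (∀ s' : ℕ, InitialDataSet.dataWeightedSobolevEDist s' δ D (Kerr.data M a M hM.le) < ⊤) →
            InitialDataSet.dataWeightedSobolevEDist s δ D (Kerr.data M a M hM.le) <
              ENNReal.ofReal ε →
            ∀ 𝒟 : VacuumCauchyDevelopment D, 𝒟.IsMaximal →
              ∃ (M' a' : ℝ), Kerr.IsSubextremal M' a' ∧ 𝒟.HasCompleteFutureNullInfinityFar ∧
                (∃ (τ₀ : ℝ) (Ψ : Kerr.exterior M' a' → 𝒟.carrier),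
                  ContMDiff 𝓘(ℝ, E4) (𝓡 4) ∞ Ψ ∧
                  IsOpenEmbedding ((Kerr.lateRegion M' a' τ₀).restrict Ψ) ∧
                  Tendsto (fun τ ↦ 𝒟.toSpacetime.deviationCk (Kerr.background M' a') Ψ 2 τ)
                    atTop (𝓝 0)) ∧
                |M' - M| + |a' - a| ≤ η := by
  rw [bulkKerrCaptureC2_iff]
  have key : ∀ {a M : ℝ} {D : InitialDataSet 𝓘(ℝ, E3) (Kerr.slice a M)}
      [Kerr.SliceFacts] (𝒟 : VacuumCauchyDevelopment D) (η : ℝ),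
      (∃ (M' a' : ℝ) (𝒟oc : Set 𝒟.carrier), Kerr.IsSubextremal M' a' ∧
          𝒟.HasCompleteFutureNullInfinityFar ∧
          𝒟.toSpacetime.ConvergesToKerr 𝒟oc M' a' 2 ∧ |M' - M| + |a' - a| ≤ η) ↔
      ∃ (M' a' : ℝ), Kerr.IsSubextremal M' a' ∧ 𝒟.HasCompleteFutureNullInfinityFar ∧
        (∃ (τ₀ : ℝ) (Ψ : Kerr.exterior M' a' → 𝒟.carrier),
          ContMDiff 𝓘(ℝ, E4) (𝓡 4) ∞ Ψ ∧
          IsOpenEmbedding ((Kerr.lateRegion M' a' τ₀).restrict Ψ) ∧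
          Tendsto (fun τ ↦ 𝒟.toSpacetime.deviationCk (Kerr.background M' a') Ψ 2 τ)
            atTop (𝓝 0)) ∧
        |M' - M| + |a' - a| ≤ η := by
    intro a M D _ 𝒟 η
    constructor
    · rintro ⟨M', a', 𝒟oc, hsub, hfar, hconv, hmod⟩
      exact ⟨M', a', hsub, hfar,
        (exists_convergesToKerr_iff_chart 𝒟.toSpacetime M' a' 2).1 ⟨𝒟oc, hconv⟩, hmod⟩
    · rintro ⟨M', a', hsub, hfar, hchart, hmod⟩
      obtain ⟨𝒟oc, hconv⟩ := (exists_convergesToKerr_iff_chart 𝒟.toSpacetime M' a' 2).2 hchart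
      exact ⟨M', a', 𝒟oc, hsub, hfar, hconv, hmod⟩
  constructor
  · intro h hF hSF a₁ ha₁
    obtain ⟨s, δ, H⟩ := @h hF hSF a₁ ha₁
    refine ⟨s, δ, fun M hM η hη ↦ ?_⟩
    obtain ⟨ε, hε, Hε⟩ := H M hM η hη
    exact ⟨ε, hε, fun a ha D _ hvac hcon hdist 𝒟 hmax ↦
      (key 𝒟 η).1 (Hε a ha D hvac hcon hdist 𝒟 hmax)⟩
  · intro h hF hSF a₁ ha₁
    obtain ⟨s, δ, H⟩ := @h hF hSF a₁ ha₁
    refine ⟨s, δ, fun M hM η hη ↦ ?_⟩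
    obtain ⟨ε, hε, Hε⟩ := H M hM η hη
    exact ⟨ε, hε, fun a ha D _ hvac hcon hdist 𝒟 hmax ↦
      (key 𝒟 η).2 (Hε a ha D hvac hcon hdist 𝒟 hmax)⟩

/-! ## §3 The qualitative modulus tolerates the corners -/

/-- For every tolerance `η > 0` and every CLOSED-range pair `|a| ≤ M` (extremal and zero-mass corners
included) there are SUB-extremal parameters within `η`. Hence the conclusion
`∃ M' a', IsSubextremal M' a' ∧ … ∧ |M' − M| + |a' − a| ≤ η` of the successor bulk statement is NOT
contradicted at `Kerr.data M a M` itself for `|a| = M` or `M = 0` by parameter bookkeeping alone — unlike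
the pre-ruling modulus `C · √dist = 0`, which pins `(M', a') = (M, a)` and kills the closed-range and
zero-mass strengthenings of `BulkKerrCapture` (`bulkCaptureFamily_false_without_spinGap / _posMass`).
The side conditions `a₁ < 1`, `0 < M` of `BulkKerrCaptureC2` are load-bearing only through
far-completeness and `C²` convergence, which the tree cannot evaluate. [folklore] -/
theorem exists_subextremal_within {M a η : ℝ} (ha : |a| ≤ M) (hη : 0 < η) :
    ∃ M' a' : ℝ, Kerr.IsSubextremal M' a' ∧ |M' - M| + |a' - a| ≤ η := by
  refine ⟨M + η / 2, a, ?_, ?_⟩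
  · unfold Kerr.IsSubextremal
    linarith
  · have h1 : |M + η / 2 - M| = η / 2 := by
      rw [add_sub_cancel_left, abs_of_pos (by linarith)]
    rw [h1, sub_self, abs_zero, add_zero]
    linarith

end Summit.FinalStateConjecture.FinalStateConjecture.Theorems.CaptureSufficesC2.Negative

end
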